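import Mathlib.LinearAlgebra.Alternating.Uncurry.Fin
import Literature.Algebra.Lie.ChevalleyEilenbergDirectSum
import Literature.NumberTheory.Automorphic.ResGLnKugaAdInvariance
import Literature.NumberTheory.Automorphic.ResGLnConeDictionaryCone
import Literature.NumberTheory.Automorphic.ResGLnCuspidalCohomologyApexLevel
import HarnessLib

/-!
# The formal adjoint `D*` of the tuple model is `-(q+1)` times the Kuga homotopy, which preserves the
# level-`𝔫`, `K'`-relative `(𝔤, K_∞)`-cochains — crux HeckeEigenvalueField (stmt-Langlands-13632),
# line Sketch, stub END-DSTAR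

Statement.  Let `π` be a cuspidal automorphic representation datum of `GL_n(𝔸_K)`, `W ⊗ E_λ` the value
module of the `(𝔤, K_∞)`-complex `gkComplexLS π S λ` (`ResGLnConeDictionary`), `x = xD` the orthonormal
basis of `𝔭₀`, `K' = 𝔨 ⊕ ℝ·1` (`kPrimeD`) and `s = kugaS = π ⊗ 1 - 1 ⊗ dE_λ` (`ResGLnKugaData`).  For a
cochain `θ ∈ C^{q+1}(𝔤, K_∞; W ⊗ E_λ)` which is `K'`-relative and whose values are `K(𝔫)`-fixed:
(A) the Casimir homotopy `h θ = ∑_b s(x_b) ∘ i_{x_b} θ` is again in the `(𝔤, K_∞)`-complex, `K'`-relative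
and level-fixed; (B) for every tuple `J` of basis indices,
`∑ᵢ ∑_b (-1)ⁱ L†_b θ(x ∘ ins_i b J) = -(q+1) (h θ)(x ∘ J)` with `L†_b = -s(x_b)` (END-PAIR).

Proof.  (A) On `K'`-horizontal cochains the homotopy of the `𝔭₀`-part `∑_b x_b ⊗ x_b` agrees with the
homotopy of the full canonical tensor `∑_b x_b ⊗ x_b + ∑_a w_a ⊗ w'_a` of the trace form (`w'_a ∈ K'`,
`casimirHomotopy_sumElim_eq`), which is `𝔤`-invariant (`kugaD_hT`) and `Ad K_∞`-invariant (`kugaD_hTK`),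
while `s` is `𝔤`-equivariant (`kugaS_equivariant`) and `K_∞`-equivariant (`sigmaLeft/Right_equivariantK`);
so the tree's `casimirHomotopy_mem_gK` and `casimirHomotopy_mem_rel` apply [cite: BorelWallach2000, I §5.1].
Level-fixedness: `r(u) ⊗ 1` commutes with `π(X) ⊗ 1` (`lieRepW_comp_finiteRepW`) and with `1 ⊗ dE(X)`.
(B) For an alternating `θ`, inserting `x_b` at slot `i` is `(-1)ⁱ` times inserting it in front
(`AlternatingMap.neg_one_pow_smul_map_insertNth`), so every `(i, b)` term is `-(s(x_b) (i_{x_b} θ)(x ∘ J))`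
and the `i`-sum contributes the factor `q + 1` [cite: BorelWallach2000, II §2.2–2.5].

## References

* A. Borel, N. Wallach, *Continuous cohomology, discrete subgroups, and representations of
  reductive groups*, 2nd ed., Math. Surveys Monogr. 67 (2000), I §5.1, II §2.2–2.5.
  [BorelWallach2000]
* A. Borel, H. Jacquet, *Automorphic forms and automorphic representations*, Proc. Sympos. Pure
  Math. 33 (Corvallis 1977), Part 1 (1979), 189–202, §4.6 (right translations by `G(𝔸_f)` commute
  with the archimedean operations). [BorelJacquetCorvallis1979]

Theorems only (no definitions, no named facts).
-/

set_option linter.dupNamespace false -- project-wide: `Summit.Langlands.Langlands` is the mandated namespace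

noncomputable section

open scoped TensorProduct Classical Matrix ComplexConjugate
open MeasureTheory NumberField NumberField.mixedEmbedding Literature.NumberTheory.Automorphic
open Literature.Algebra.Lie Literature.Algebra.Lie.ChevalleyEilenberg

namespace Summit.Langlands.Langlands.Theorems.HeckeEigenvalueField.Res

namespace EndDstar

variable {n : ℕ} {K : Type} [Field K] [NumberField K] {hcpt : isCompact_glFiniteIntegralLevel n K}
  (π : AutomorphicRepData (AutomorphyDatum.gl n K hcpt)) (lam : (K →+* ℂ) → Fin n → ℤ)

/-- **Reindexing**: for an alternating cochain `θ` with values in `W ⊗ E_λ`, inserting `x_b` at slot `i`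
of a basis tuple is `(-1)ⁱ` times inserting it in front (`AlternatingMap.neg_one_pow_smul_map_insertNth`,
read in `W ⊗ E_λ` with complex scalars). [folklore] -/
theorem neg_one_pow_smul_apply_xD_insertNth {q : ℕ} (θ : ConeDictionary.Cochain π lam (q + 1))
    (i : Fin (q + 1)) (b : Fin (ResGLnCartan.pZeroDim n K)) (J : Fin q → Fin (ResGLnCartan.pZeroDim n K)) :
    ((-1 : ℂ) ^ (i : ℕ)) • @id (π.W ⊗[ℂ] ResGLnCohomology.CoeffModule ℂ n K lam)
        (θ (fun j => ConeDictionary.xD n K hcpt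
          ((Fin.insertNth i b J : Fin (q + 1) → Fin (ResGLnCartan.pZeroDim n K)) j))) =
      @id (π.W ⊗[ℂ] ResGLnCohomology.CoeffModule ℂ n K lam)
        (θ (Matrix.vecCons (ConeDictionary.xD n K hcpt b) fun j => ConeDictionary.xD n K hcpt (J j))) := by
  have e : (fun j => ConeDictionary.xD n K hcpt
      ((Fin.insertNth i b J : Fin (q + 1) → Fin (ResGLnCartan.pZeroDim n K)) j)) =
      i.insertNth (ConeDictionary.xD n K hcpt b) (fun j => ConeDictionary.xD n K hcpt (J j)) :=
    Fin.eq_insertNth_iff.2 ⟨by simp, funext fun j => by simp [Fin.removeNth]⟩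
  have h := θ.neg_one_pow_smul_map_insertNth i (ConeDictionary.xD n K hcpt b)
    (fun j => ConeDictionary.xD n K hcpt (J j))
  rw [← e, ← Int.cast_smul_eq_zsmul ℂ, Int.cast_pow, Int.cast_neg, Int.cast_one] at h
  exact h

/-- **The Kuga homotopy evaluated**: `(h θ)(v) = ∑_b (π(x_b) ⊗ 1 - 1 ⊗ dE(x_b)) θ(x_b, v)` in `W ⊗ E_λ`
(`casimirHomotopy_apply`, `s = σ₁ - σ₂`). [cite: BorelWallach2000, II §2.5] -/
theorem id_casimirHomotopy_kugaS_apply {q : ℕ} (θ : ConeDictionary.Cochain π lam (q + 1))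
    (v : Fin q → (AutomorphyDatum.gl n K hcpt).arch.lie) :
    @id (π.W ⊗[ℂ] ResGLnCohomology.CoeffModule ℂ n K lam)
        (casimirHomotopy (ConeDictionary.kugaS π lam) (ConeDictionary.xD n K hcpt) (ConeDictionary.xD n K hcpt) q θ v) =
      ∑ b : Fin (ResGLnCartan.pZeroDim n K),
        ((π.lieRepW (ConeDictionary.xD n K hcpt b)).rTensor (ResGLnCohomology.CoeffModule ℂ n K lam)
            (@id (π.W ⊗[ℂ] ResGLnCohomology.CoeffModule ℂ n K lam)
              (θ (Matrix.vecCons (ConeDictionary.xD n K hcpt b) v))) -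
          (ConeDictionary.σ𝔤S hcpt lam (ConeDictionary.xD n K hcpt b)).lTensor π.W
            (@id (π.W ⊗[ℂ] ResGLnCohomology.CoeffModule ℂ n K lam)
              (θ (Matrix.vecCons (ConeDictionary.xD n K hcpt b) v)))) := by
  rw [casimirHomotopy_apply, finset_sum_apply]
  rfl

/-! ### The four parts of the stub, over a general automorphic representation datum `π` -/

/-- `θ` `K'`-relative ⟹ `θ` is `K'`-horizontal, so the `𝔭₀`-homotopy of `θ` is the homotopy of the FULL
canonical tensor `∑_b x_b ⊗ x_b + ∑_a w_a ⊗ w'_a` (`w'_a ∈ K'`, `casimirHomotopy_sumElim_eq`).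
[cite: BorelWallach2000, II Prop. 2.3] -/
theorem casimirHomotopy_sumElim_eq_xD {q : ℕ} {θ : ConeDictionary.Cochain π lam (q + 1)}
    (hrel : θ ∈ (Subcomplex.rel ℝ (ConeDictionary.𝔤D n K hcpt) (ConeDictionary.Carrier π lam)
      (ConeDictionary.kPrimeD n K hcpt)).carrier (q + 1)) :
    casimirHomotopy (ConeDictionary.kugaS π lam) (Sum.elim (ConeDictionary.xD n K hcpt) (ConeDictionary.wD n K hcpt))
        (Sum.elim (ConeDictionary.xD n K hcpt) (ConeDictionary.w'D n K hcpt)) q θ =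
      casimirHomotopy (ConeDictionary.kugaS π lam) (ConeDictionary.xD n K hcpt) (ConeDictionary.xD n K hcpt) q θ :=
  casimirHomotopy_sumElim_eq (ConeDictionary.kPrimeD n K hcpt) (ConeDictionary.kugaS π lam)
    (ConeDictionary.xD n K hcpt) (ConeDictionary.wD n K hcpt) (ConeDictionary.w'D n K hcpt)
    (ConeDictionary.kugaD_hw' n K hcpt) (Submodule.mem_inf.1 hrel).2

/-- **(A1)** The Kuga homotopy preserves the `(𝔤, K_∞)`-complex: the tree's `casimirHomotopy_mem_gK` for the full
canonical tensor, which is `𝔤`-invariant (`kugaD_hT`) and `Ad K_∞`-invariant (`kugaD_hTK`), `s = σ₁ - σ₂` being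
`𝔤`-equivariant (`kugaS_equivariant`) and `K_∞`-equivariant (`sigmaLeft/Right_equivariantK`).
[cite: BorelWallach2000, I §5.1] -/
theorem casimirHomotopy_mem_gkComplexLS (S : Finset {w : InfinitePlace K // w.IsReal}) {q : ℕ}
    {θ : ConeDictionary.Cochain π lam (q + 1)} (hθ : θ ∈ (ConeDictionary.gkComplexLS π S lam).carrier (q + 1))
    (hrel : θ ∈ (Subcomplex.rel ℝ (ConeDictionary.𝔤D n K hcpt) (ConeDictionary.Carrier π lam)
      (ConeDictionary.kPrimeD n K hcpt)).carrier (q + 1)) :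
    casimirHomotopy (ConeDictionary.kugaS π lam) (ConeDictionary.xD n K hcpt) (ConeDictionary.xD n K hcpt) q θ ∈
      (ConeDictionary.gkComplexLS π S lam).carrier q := by
  rw [← casimirHomotopy_sumElim_eq_xD π lam hrel]
  refine casimirHomotopy_mem_gK _ _ (ConeDictionary.kugaS_equivariant π lam) (ConeDictionary.kugaD_hT n K hcpt)
    (fun g u => ?_) (fun g => ?_) q θ hθ
  · -- `K_∞`-equivariance of `s = σ₁ - σ₂` from that of `σ₁ = π ⊗ 1` and `σ₂ = 1 ⊗ dE` (closed terms,
    -- no `rw`: the pair-action terms over the datum are expensive to unify against patterns)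
    have h1 := GKTensor.sigmaLeft_equivariantK (AutomorphyDatum.gl n K hcpt).arch π.kRepW π.lieRepW
      π.kRepW_lieRepW_ad_compat (ConeDictionary.σSK hcpt S lam) (ConeDictionary.σ𝔤S hcpt lam)
      (ConeDictionary.σS_ad_compat S lam) g u
    have h2 := GKTensor.sigmaRight_equivariantK (AutomorphyDatum.gl n K hcpt).arch π.kRepW π.lieRepW
      π.kRepW_lieRepW_ad_compat (ConeDictionary.σSK hcpt S lam) (ConeDictionary.σ𝔤S hcpt lam)
      (ConeDictionary.σS_ad_compat S lam) g u
    exact (LinearMap.comp_sub _ _ _).trans ((congrArg₂ (· - ·) h1 h2).trans (LinearMap.sub_comp _ _ _).symm)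
  · rw [ConeDictionary.sumElim_xD_wD, ConeDictionary.sumElim_xD_w'D]
    exact ConeDictionary.kugaD_hTK n K hcpt g

/-- **(A2)** The Kuga homotopy preserves the `K'`-relative complex (`casimirHomotopy_mem_rel` for the full tensor).
[cite: BorelWallach2000, I §1.2, §5.1] -/
theorem casimirHomotopy_mem_rel_kPrimeD {q : ℕ} {θ : ConeDictionary.Cochain π lam (q + 1)}
    (hrel : θ ∈ (Subcomplex.rel ℝ (ConeDictionary.𝔤D n K hcpt) (ConeDictionary.Carrier π lam)
      (ConeDictionary.kPrimeD n K hcpt)).carrier (q + 1)) :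
    casimirHomotopy (ConeDictionary.kugaS π lam) (ConeDictionary.xD n K hcpt) (ConeDictionary.xD n K hcpt) q θ ∈
      (Subcomplex.rel ℝ (ConeDictionary.𝔤D n K hcpt) (ConeDictionary.Carrier π lam)
        (ConeDictionary.kPrimeD n K hcpt)).carrier q := by
  rw [← casimirHomotopy_sumElim_eq_xD π lam hrel]
  exact casimirHomotopy_mem_rel (ConeDictionary.kPrimeD n K hcpt) (ConeDictionary.kugaS_equivariant π lam)
    (ConeDictionary.kugaD_hT n K hcpt) q θ hrel

/-- **(A3)** The Kuga homotopy preserves level-`𝔫`-fixed cochains: `r(u) ⊗ 1` commutes with `π(X) ⊗ 1`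
(`lieRepW_comp_finiteRepW`) and with `1 ⊗ dE(X)`. [cite: BorelJacquetCorvallis1979, 4.6] -/
theorem isLevelFixed_casimirHomotopy (𝔫 : Ideal (𝓞 K)) {q : ℕ} {θ : ConeDictionary.Cochain π lam (q + 1)}
    (hfix : ConeDictionary.IsLevelFixed π lam 𝔫 θ) :
    ConeDictionary.IsLevelFixed π lam 𝔫
      (casimirHomotopy (ConeDictionary.kugaS π lam) (ConeDictionary.xD n K hcpt) (ConeDictionary.xD n K hcpt) q θ) := by
  intro w u hu
  rw [id_casimirHomotopy_kugaS_apply, map_sum]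
  refine Finset.sum_congr rfl fun s _ => ?_
  have hF := hfix (Matrix.vecCons (ConeDictionary.xD n K hcpt s) w) u hu
  have c1 : (π.finiteRepW ⟨GLn.ofFinite n K u, u, rfl⟩).rTensor (ResGLnCohomology.CoeffModule ℂ n K lam) ∘ₗ
      (π.lieRepW (ConeDictionary.xD n K hcpt s)).rTensor (ResGLnCohomology.CoeffModule ℂ n K lam) =
      (π.lieRepW (ConeDictionary.xD n K hcpt s)).rTensor (ResGLnCohomology.CoeffModule ℂ n K lam) ∘ₗ
        (π.finiteRepW ⟨GLn.ofFinite n K u, u, rfl⟩).rTensor (ResGLnCohomology.CoeffModule ℂ n K lam) := by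
    rw [← LinearMap.rTensor_comp, ← ConeDictionary.lieRepW_comp_finiteRepW π (ConeDictionary.xD n K hcpt s),
      LinearMap.rTensor_comp]
  have c2 : (π.finiteRepW ⟨GLn.ofFinite n K u, u, rfl⟩).rTensor (ResGLnCohomology.CoeffModule ℂ n K lam) ∘ₗ
      (ConeDictionary.σ𝔤S hcpt lam (ConeDictionary.xD n K hcpt s)).lTensor π.W =
      (ConeDictionary.σ𝔤S hcpt lam (ConeDictionary.xD n K hcpt s)).lTensor π.W ∘ₗ
        (π.finiteRepW ⟨GLn.ofFinite n K u, u, rfl⟩).rTensor (ResGLnCohomology.CoeffModule ℂ n K lam) := by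
    rw [LinearMap.rTensor_comp_lTensor, LinearMap.lTensor_comp_rTensor]
  have e1 := LinearMap.congr_fun c1
    (@id (π.W ⊗[ℂ] ResGLnCohomology.CoeffModule ℂ n K lam) (θ (Matrix.vecCons (ConeDictionary.xD n K hcpt s) w)))
  have e2 := LinearMap.congr_fun c2
    (@id (π.W ⊗[ℂ] ResGLnCohomology.CoeffModule ℂ n K lam) (θ (Matrix.vecCons (ConeDictionary.xD n K hcpt s) w)))
  simp only [LinearMap.comp_apply] at e1 e2
  rw [map_sub, e1, e2, hF]

set_option maxHeartbeats 400000 in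
-- the closed-term chains are checked by definitional unfolding of the statement's tensor-product instances
/-- **(B)** The formal adjoint on basis tuples: `∑ᵢ ∑_b (-1)ⁱ L†_b θ(x ∘ ins_i b J) = -(q+1) (h θ)(x ∘ J)`,
`L†_b = -(π(x_b) ⊗ 1 - 1 ⊗ dE(x_b))`. [cite: BorelWallach2000, II §2.2–2.5] -/
theorem dstar_sum_eq {q : ℕ} (θ : ConeDictionary.Cochain π lam (q + 1)) (J : Fin q → Fin (ResGLnCartan.pZeroDim n K)) :
    ∑ i : Fin (q + 1), ∑ b : Fin (ResGLnCartan.pZeroDim n K), ((-1 : ℂ) ^ (i : ℕ)) •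
        -(((π.lieRepW (ConeDictionary.xD n K hcpt b)).rTensor (ResGLnCohomology.CoeffModule ℂ n K lam)
              (@id (π.W ⊗[ℂ] ResGLnCohomology.CoeffModule ℂ n K lam)
                (θ (fun j => ConeDictionary.xD n K hcpt
                  ((Fin.insertNth i b J : Fin (q + 1) → Fin (ResGLnCartan.pZeroDim n K)) j))))) -
            ((ConeDictionary.σ𝔤S hcpt lam (ConeDictionary.xD n K hcpt b)).lTensor π.W
              (@id (π.W ⊗[ℂ] ResGLnCohomology.CoeffModule ℂ n K lam)
                (θ (fun j => ConeDictionary.xD n K hcpt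
                  ((Fin.insertNth i b J : Fin (q + 1) → Fin (ResGLnCartan.pZeroDim n K)) j)))))) =
      -(((q + 1 : ℕ) : ℂ) • @id (π.W ⊗[ℂ] ResGLnCohomology.CoeffModule ℂ n K lam)
        (casimirHomotopy (ConeDictionary.kugaS π lam) (ConeDictionary.xD n K hcpt) (ConeDictionary.xD n K hcpt) q θ
          (fun j => ConeDictionary.xD n K hcpt (J j)))) := by
  -- All sign/scalar steps are CLOSED instances of the module lemmas chained by `Eq.trans`: on `W ⊗ E_λ`
  -- (`W` a submodule of functions) the generic `rw [smul_neg]`-type patterns do not unify with the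
  -- statement's direct tensor-product instances.
  have hC := id_casimirHomotopy_kugaS_apply π lam θ (fun j => ConeDictionary.xD n K hcpt (J j))
  -- pointwise: `(-1)ⁱ • -(L_b θ(x ∘ ins_i b J)) = -(L_b θ(x_b, x ∘ J))`, `L_b = π(x_b) ⊗ 1 - 1 ⊗ dE(x_b)`
  have hpt : ∀ (i : Fin (q + 1)) (b : Fin (ResGLnCartan.pZeroDim n K)),
      ((-1 : ℂ) ^ (i : ℕ)) •
        -((π.lieRepW (ConeDictionary.xD n K hcpt b)).rTensor (ResGLnCohomology.CoeffModule ℂ n K lam)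
              (@id (π.W ⊗[ℂ] ResGLnCohomology.CoeffModule ℂ n K lam)
                (θ (fun j => ConeDictionary.xD n K hcpt
                  ((Fin.insertNth i b J : Fin (q + 1) → Fin (ResGLnCartan.pZeroDim n K)) j)))) -
            (ConeDictionary.σ𝔤S hcpt lam (ConeDictionary.xD n K hcpt b)).lTensor π.W
              (@id (π.W ⊗[ℂ] ResGLnCohomology.CoeffModule ℂ n K lam)
                (θ (fun j => ConeDictionary.xD n K hcpt
                  ((Fin.insertNth i b J : Fin (q + 1) → Fin (ResGLnCartan.pZeroDim n K)) j))))) =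
      -((π.lieRepW (ConeDictionary.xD n K hcpt b)).rTensor (ResGLnCohomology.CoeffModule ℂ n K lam)
            (@id (π.W ⊗[ℂ] ResGLnCohomology.CoeffModule ℂ n K lam)
              (θ (Matrix.vecCons (ConeDictionary.xD n K hcpt b) fun j => ConeDictionary.xD n K hcpt (J j)))) -
          (ConeDictionary.σ𝔤S hcpt lam (ConeDictionary.xD n K hcpt b)).lTensor π.W
            (@id (π.W ⊗[ℂ] ResGLnCohomology.CoeffModule ℂ n K lam)
              (θ (Matrix.vecCons (ConeDictionary.xD n K hcpt b) fun j => ConeDictionary.xD n K hcpt (J j))))) := by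
    intro i b
    have key := neg_one_pow_smul_apply_xD_insertNth π lam θ i b J
    have h1 :=
      (map_smul
        ((π.lieRepW (ConeDictionary.xD n K hcpt b)).rTensor (ResGLnCohomology.CoeffModule ℂ n K lam))
        ((-1 : ℂ) ^ (i : ℕ))
        (@id (π.W ⊗[ℂ] ResGLnCohomology.CoeffModule ℂ n K lam)
          (θ (fun j => ConeDictionary.xD n K hcpt
            ((Fin.insertNth i b J : Fin (q + 1) → Fin (ResGLnCartan.pZeroDim n K)) j))))).symm.trans
      (congrArg
        (fun y => (π.lieRepW (ConeDictionary.xD n K hcpt b)).rTensor (ResGLnCohomology.CoeffModule ℂ n K lam) y)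
        key)
    have h2 :=
      (map_smul
        ((ConeDictionary.σ𝔤S hcpt lam (ConeDictionary.xD n K hcpt b)).lTensor π.W)
        ((-1 : ℂ) ^ (i : ℕ))
        (@id (π.W ⊗[ℂ] ResGLnCohomology.CoeffModule ℂ n K lam)
          (θ (fun j => ConeDictionary.xD n K hcpt
            ((Fin.insertNth i b J : Fin (q + 1) → Fin (ResGLnCartan.pZeroDim n K)) j))))).symm.trans
      (congrArg
        (fun y => (ConeDictionary.σ𝔤S hcpt lam (ConeDictionary.xD n K hcpt b)).lTensor π.W y)
        key)
    exact (smul_neg ((-1 : ℂ) ^ (i : ℕ))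
      ((π.lieRepW (ConeDictionary.xD n K hcpt b)).rTensor (ResGLnCohomology.CoeffModule ℂ n K lam)
          (@id (π.W ⊗[ℂ] ResGLnCohomology.CoeffModule ℂ n K lam)
            (θ (fun j => ConeDictionary.xD n K hcpt
              ((Fin.insertNth i b J : Fin (q + 1) → Fin (ResGLnCartan.pZeroDim n K)) j)))) -
        (ConeDictionary.σ𝔤S hcpt lam (ConeDictionary.xD n K hcpt b)).lTensor π.W
          (@id (π.W ⊗[ℂ] ResGLnCohomology.CoeffModule ℂ n K lam)
            (θ (fun j => ConeDictionary.xD n K hcpt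
              ((Fin.insertNth i b J : Fin (q + 1) → Fin (ResGLnCartan.pZeroDim n K)) j)))))).trans
      (congrArg Neg.neg
        ((smul_sub ((-1 : ℂ) ^ (i : ℕ))
          ((π.lieRepW (ConeDictionary.xD n K hcpt b)).rTensor (ResGLnCohomology.CoeffModule ℂ n K lam)
            (@id (π.W ⊗[ℂ] ResGLnCohomology.CoeffModule ℂ n K lam)
              (θ (fun j => ConeDictionary.xD n K hcpt
                ((Fin.insertNth i b J : Fin (q + 1) → Fin (ResGLnCartan.pZeroDim n K)) j)))))
          ((ConeDictionary.σ𝔤S hcpt lam (ConeDictionary.xD n K hcpt b)).lTensor π.W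
            (@id (π.W ⊗[ℂ] ResGLnCohomology.CoeffModule ℂ n K lam)
              (θ (fun j => ConeDictionary.xD n K hcpt
                ((Fin.insertNth i b J : Fin (q + 1) → Fin (ResGLnCartan.pZeroDim n K)) j)))))).trans
          (congrArg₂ (· - ·) h1 h2)))
  -- the inner sum over `b` is `-(h θ)(x ∘ J)`, independently of `i`
  have hinner : ∀ i : Fin (q + 1),
      ∑ b : Fin (ResGLnCartan.pZeroDim n K), ((-1 : ℂ) ^ (i : ℕ)) •
        -((π.lieRepW (ConeDictionary.xD n K hcpt b)).rTensor (ResGLnCohomology.CoeffModule ℂ n K lam)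
              (@id (π.W ⊗[ℂ] ResGLnCohomology.CoeffModule ℂ n K lam)
                (θ (fun j => ConeDictionary.xD n K hcpt
                  ((Fin.insertNth i b J : Fin (q + 1) → Fin (ResGLnCartan.pZeroDim n K)) j)))) -
            (ConeDictionary.σ𝔤S hcpt lam (ConeDictionary.xD n K hcpt b)).lTensor π.W
              (@id (π.W ⊗[ℂ] ResGLnCohomology.CoeffModule ℂ n K lam)
                (θ (fun j => ConeDictionary.xD n K hcpt
                  ((Fin.insertNth i b J : Fin (q + 1) → Fin (ResGLnCartan.pZeroDim n K)) j))))) =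
      -(@id (π.W ⊗[ℂ] ResGLnCohomology.CoeffModule ℂ n K lam)
        (casimirHomotopy (ConeDictionary.kugaS π lam) (ConeDictionary.xD n K hcpt) (ConeDictionary.xD n K hcpt) q θ
          (fun j => ConeDictionary.xD n K hcpt (J j)))) := fun i => by
    rw [hC]
    exact (Finset.sum_congr rfl fun b _ => hpt i b).trans
      (Finset.sum_neg_distrib (s := Finset.univ)
        (f := fun b : Fin (ResGLnCartan.pZeroDim n K) =>
          (π.lieRepW (ConeDictionary.xD n K hcpt b)).rTensor (ResGLnCohomology.CoeffModule ℂ n K lam)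
              (@id (π.W ⊗[ℂ] ResGLnCohomology.CoeffModule ℂ n K lam)
                (θ (Matrix.vecCons (ConeDictionary.xD n K hcpt b) fun j => ConeDictionary.xD n K hcpt (J j)))) -
            (ConeDictionary.σ𝔤S hcpt lam (ConeDictionary.xD n K hcpt b)).lTensor π.W
              (@id (π.W ⊗[ℂ] ResGLnCohomology.CoeffModule ℂ n K lam)
                (θ (Matrix.vecCons (ConeDictionary.xD n K hcpt b) fun j => ConeDictionary.xD n K hcpt (J j))))))
  refine (Finset.sum_congr rfl fun i _ => hinner i).trans ?_
  rw [Finset.sum_const, Finset.card_univ, Fintype.card_fin]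
  exact (Nat.cast_smul_eq_nsmul ℂ (q + 1)
    (-(@id (π.W ⊗[ℂ] ResGLnCohomology.CoeffModule ℂ n K lam)
        (casimirHomotopy (ConeDictionary.kugaS π lam) (ConeDictionary.xD n K hcpt) (ConeDictionary.xD n K hcpt) q θ
          (fun j => ConeDictionary.xD n K hcpt (J j)))))).symm.trans
    (smul_neg (((q + 1 : ℕ) : ℂ))
      (@id (π.W ⊗[ℂ] ResGLnCohomology.CoeffModule ℂ n K lam)
        (casimirHomotopy (ConeDictionary.kugaS π lam) (ConeDictionary.xD n K hcpt) (ConeDictionary.xD n K hcpt) q θ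
          (fun j => ConeDictionary.xD n K hcpt (J j)))))


end EndDstar

/-- **Stub END-DSTAR — the formal adjoint `D*` of the tuple model is `-(q+1)` times the homotopy of
`s = π ⊗ 1 - 1 ⊗ dE_λ` along `xD`, and that homotopy preserves the level-`𝔫`, `K'`-relative
`(𝔤, K_∞)`-cochains.**  Reindexing: inserting `x_b` at slot `i` of an alternating cochain is `(-1)ⁱ` times
inserting it in front, so `∑ᵢ ∑_b (-1)ⁱ L†_b θ(ins_i b J) = (q+1) ∑_b L†_b (i_{x_b} θ)(x ∘ J)` with
`L†_b = -s(x_b)` (END-PAIR); membership: `K'`-relativity by the 𝔨/𝔨'-restricted Casimir-homotopy lemma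
(landed TUPLE-K `stub_casimirHomotopy_mem_gK_of_compact` / tree `casimirHomotopy_mem_rel` with
`kugaS_equivariant`, `kugaD_hT`), `K_∞`-fixedness by `act_casimirHomotopy` (`kugaS` is `K_∞`-equivariant by
`ad_compat` of both factors; the `𝔭₀`-tensor is `Ad K_∞`-invariant, `kugaD_hTK` read on the `x`-part),
level by `r(u) ⊗ 1` commuting with `s` and with insertions. [cite: BorelWallach2000, I §5.1 and II §2.2–2.5] -/
theorem stub_end_dstar {n : ℕ} {K : Type} [Field K] [NumberField K]
    (hcpt : isCompact_glFiniteIntegralLevel n K) (𝔫 : Ideal (𝓞 K))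
    (π : CuspidalAutomorphicRepData n K hcpt)
    (S : Finset {w : InfinitePlace K // w.IsReal}) (lam : (K →+* ℂ) → Fin n → ℤ) {q : ℕ}
    (θ : ConeDictionary.Cochain π.1 lam (q + 1)) :
    (θ ∈ (ConeDictionary.gkComplexLS π.1 S lam).carrier (q + 1)) →
      (θ ∈ (Subcomplex.rel ℝ (ConeDictionary.𝔤D n K hcpt) (ConeDictionary.Carrier π.1 lam)
        (ConeDictionary.kPrimeD n K hcpt)).carrier (q + 1)) →
      ConeDictionary.IsLevelFixed π.1 lam 𝔫 θ →
    ((casimirHomotopy (ConeDictionary.kugaS π.1 lam) (ConeDictionary.xD n K hcpt) (ConeDictionary.xD n K hcpt) q θ ∈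
        (ConeDictionary.gkComplexLS π.1 S lam).carrier q) ∧
      (casimirHomotopy (ConeDictionary.kugaS π.1 lam) (ConeDictionary.xD n K hcpt) (ConeDictionary.xD n K hcpt) q θ ∈
        (Subcomplex.rel ℝ (ConeDictionary.𝔤D n K hcpt) (ConeDictionary.Carrier π.1 lam)
          (ConeDictionary.kPrimeD n K hcpt)).carrier q) ∧
      ConeDictionary.IsLevelFixed π.1 lam 𝔫
        (casimirHomotopy (ConeDictionary.kugaS π.1 lam) (ConeDictionary.xD n K hcpt) (ConeDictionary.xD n K hcpt) q θ)) ∧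
    ∀ J : Fin q → Fin (ResGLnCartan.pZeroDim n K),
      ∑ i : Fin (q + 1), ∑ b : Fin (ResGLnCartan.pZeroDim n K), ((-1 : ℂ) ^ (i : ℕ)) •
          -(((π.1.lieRepW (ConeDictionary.xD n K hcpt b)).rTensor (ResGLnCohomology.CoeffModule ℂ n K lam)
                (@id (π.1.W ⊗[ℂ] ResGLnCohomology.CoeffModule ℂ n K lam)
                  (θ (fun j => ConeDictionary.xD n K hcpt
                    ((Fin.insertNth i b J : Fin (q + 1) → Fin (ResGLnCartan.pZeroDim n K)) j))))) -
              ((ConeDictionary.σ𝔤S hcpt lam (ConeDictionary.xD n K hcpt b)).lTensor π.1.W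
                (@id (π.1.W ⊗[ℂ] ResGLnCohomology.CoeffModule ℂ n K lam)
                  (θ (fun j => ConeDictionary.xD n K hcpt
                    ((Fin.insertNth i b J : Fin (q + 1) → Fin (ResGLnCartan.pZeroDim n K)) j)))))) =
        -(((q + 1 : ℕ) : ℂ) • @id (π.1.W ⊗[ℂ] ResGLnCohomology.CoeffModule ℂ n K lam)
          (casimirHomotopy (ConeDictionary.kugaS π.1 lam) (ConeDictionary.xD n K hcpt) (ConeDictionary.xD n K hcpt) q θ
            (fun j => ConeDictionary.xD n K hcpt (J j)))) := by
  intro hθ hrel hfix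
  exact ⟨⟨EndDstar.casimirHomotopy_mem_gkComplexLS π.1 lam S hθ hrel, EndDstar.casimirHomotopy_mem_rel_kPrimeD π.1 lam hrel,
    EndDstar.isLevelFixed_casimirHomotopy π.1 lam 𝔫 hfix⟩, fun J => EndDstar.dstar_sum_eq π.1 lam θ J⟩

end Summit.Langlands.Langlands.Theorems.HeckeEigenvalueField.Res

end
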